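import Mathlib.Analysis.InnerProductSpace.Projection.Basic
import Mathlib.Analysis.InnerProductSpace.PiL2
import Mathlib.Analysis.Calculus.ContDiff.Defs
import Mathlib.Analysis.SpecialFunctions.Exp
import Mathlib.MeasureTheory.Measure.Haar.InnerProductSpace
import Mathlib.MeasureTheory.Integral.Bochner.Basic
import HarnessLib

/-!
# Clozel–Delorme, *Le théorème de Paley–Wiener invariant pour les groupes de Lie réductifs II* (1990):
# THÉORÈME 1 (the invariant Paley–Wiener theorem for the real points of a connected reductive group, with limits of
# discrete series), its reformulation THÉORÈME 1′ (§5.1) and the COROLLAIRE «existence de pseudo-coefficients» (§5.2)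
# — named facts over an explicit interface; the Paley–Wiener spaces `PW_r(𝔞)` are GENUINE Mathlib objects

Topic `Literature/RepresentationTheory/ClozelDelorme1990/`; namespace `Literature.RepresentationTheory.ClozelDelorme1990`
(carpet squad TN, DEAL v3 ① G2-b to TN-t01; consumers: the h413 archimedean-transfer organs LH2 `stub_N8` ∕ LH3
`stub_N9` via ★ `Literature.NumberTheory.Rogawski1990.ArchInnerTransferCompatible`, whose docstring names «the invariant
Paley–Wiener theorem [ClozelDelorme1984, Thm. 1] by the argument of [ArthurClozel1989, Ch. 1, Lemma 7.3 (i)]»; the 1990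
paper II typed here is the version WITH limits of discrete series for `G = 𝐆(ℝ)`, which contains the 1984 statement).
Statements only: no theorem, no `sorry`, no `axiom`, no `instance`, no `notation`.  Page pins «(p. N)» are the printed
pages of Ann. Sci. ÉNS (4) 23 (1990) 193–228, read on the held numdam scan `paper:doi-10-24033-asens-1602` (file
pNNNN = printed page N + 191).

WHAT IS CONCRETE AND WHAT IS AN INTERFACE (squad COORDINATION NOTE 1 (b)).  Mathlib (pin v4.32.0) has no real
reductive Lie groups `G = 𝐆(ℝ)`, no parabolic ∕ Levi subgroups, no (limits of) discrete series, no parabolically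
induced representations `π^P_{δ,ν}`, no distribution characters `tr π(f)`, no `C_c^∞(G, K)`.  These enter through ONE
explicit interface `PWDatum 𝔞₀` (§1 below) whose fields are exactly the sets and maps the three statements quantify
over — the finite set of standard parabolics `P_i ⊇ P_∅` with `𝔞_i = Lie A_i ⊆ 𝔞_∅ =: 𝔞₀` (GENUINE subspaces of a
Euclidean space, the invariant form `B` of p. 194 being the inner product), the sets `(M̂_i)_d` of non-degenerate
limits of discrete series, the representations `π^{P_i}_{δ,ν}` as elements of a type of (classes of) representations,
the test-function space `C_c^∞(G, K)` with its support filtration `C_c^∞(G, K)_r`, the trace pairing, `K`-conjugacy of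
data and the relation (∗) of p. 194 — with NO properties; each theorem is a `Prop`-valued predicate ON such a datum,
to be asserted by a consumer for ITS datum (nothing is claimed for all data).  CONCRETE over Mathlib: the
Paley–Wiener space «`PW_r(𝔞_i)` = l'espace des transformées de Fourier de fonctions de `C_c^∞(𝔞_i)` à support dans la
boule fermée de rayon `r`» (p. 194) — `paleyWiener 𝔞 r`, functions on `(𝔞*)_ℂ = (𝔞 →ₗ[ℝ] ℂ)` of the form
`ν ↦ ∫_𝔞 φ(H) e^{ν(H)} dH` (Fourier–Laplace convention: Schwartz on the unitary axis `ν ∈ i𝔞*`, exponential type `r`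
in `Re ν`); the finite-support condition (i); the inclusion `(𝔞_j*)_ℂ ⊂ (𝔞_i*)_ℂ` for `P_i ⊂ P_j` (extension by zero
on the `B`-orthogonal complement `𝔞_i^j`, p. 194: `A_i = A_j A_i^j`) = `dualIncl`; the inverse-Fourier condition (ii)
of THÉORÈME 1′.

## CENSUS (item ↦ decl ↦ page)
* §0 setting (pp. 194–195): `C_c^∞(G, K)`, `C_c^∞(G, K)_r`, `P_i = M_iA_iN_i` (`i = 1, …, S`), `(M̂_i)_d`, `π^P_{δ,ν}`
  «basique», `PW_r(𝔞_i)`, `tr π^{P_i}_{δ,ν}`, relation (∗) ↦ interface `PWDatum` + `paleyWiener` (CONCRETE) +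
  `dualIncl` (CONCRETE);
* **THÉORÈME 1** (p. 195) ↦ `Theoreme_1` (conditions (i) `CondI`, (ii) `CondII`, (iii) `CondIII`, (iv) `CondIV`);
* §1 Définition 1 (générique, p. 197), §2 Définition 2 (affiliée, p. 200), Lemmes 1–5 (pp. 201–202), Proposition 1
  (p. 203), Proposition 2 (p. 206), §4 THÉORÈME 2 (p. 207, surjectivity of Harish-Chandra homomorphisms), Proposition 3
  (p. 208) ↦ proof-internal ∕ independent of Thm 1, NOT TYPED;
* §5.1 `Π_temp`, `J_F(G)_r`, **THÉORÈME 1′** (pp. 211–212) ↦ `TempDatum`, `unitaryAxis`, `realFunctional`, `CondJF`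
  ((ii) in Paley–Wiener form, see its docstring), `Theoreme_1prime`;
* §5.2 discrete ∕ admissible linear forms, Lemme 6, Proposition 4 (p. 212) ↦ NOT TYPED (applications; Prop. 4 needs the
  Grothendieck group `R(G)` of Harish-Chandra modules); **COROLLAIRE «existence de pseudo-coefficients»** (p. 213) ↦
  `Corollaire_pseudoCoefficient` (with the §5.2 standing hypothesis «centre de `G` compact» as `𝔞_G = 0`); THÉORÈME 3 (Euler–Poincaré functions, p. 213), THÉORÈME 4 (Dirac, p. 214),
  Appendices A–D ↦ NOT TYPED (census only).

## References
* [ClozelDelorme1990] L. Clozel, P. Delorme, *Le théorème de Paley–Wiener invariant pour les groupes de Lie réductifs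
  II*, Ann. Sci. École Norm. Sup. (4) 23 (1990) 193–228: Thm 1 p. 195, §5.1 Thm 1′ pp. 211–212, §5.2 Corollaire p. 213.
* [ClozelDelorme1984] L. Clozel, P. Delorme, *Le théorème de Paley–Wiener invariant pour les groupes de Lie
  réductifs*, Invent. Math. 77 (1984) 427–453 — print's [7] (the discrete-series case, «th. 1»; not held).
* [ArthurClozel1989] J. Arthur, L. Clozel, *Simple algebras, base change, and the advanced theory of the trace
  formula*, Ch. 1 §7 Lemma 7.3 (i) — the consumer's use.
-/

noncomputable section

open MeasureTheory

namespace Literature.RepresentationTheory.ClozelDelorme1990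

universe u v

variable (𝔞₀ : Type u) [NormedAddCommGroup 𝔞₀] [InnerProductSpace ℝ 𝔞₀] [FiniteDimensional ℝ 𝔞₀]
  [MeasurableSpace 𝔞₀] [BorelSpace 𝔞₀]

/-! ## §0 The Paley–Wiener spaces `PW_r(𝔞)` (p. 194) — concrete -/

variable {𝔞₀} in
/-- **`PW_r(𝔞)`** (p. 194): «l'espace des transformées de Fourier de fonctions de `C_c^∞(𝔞)` à support dans la boule
fermée de rayon `r > 0` de `𝔞`», for a subspace `𝔞 ⊆ 𝔞₀` of the Euclidean space `(𝔞₀, B)`: the set of functions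
`F` on the complexified dual `(𝔞*)_ℂ = (𝔞 →ₗ[ℝ] ℂ)` of the form `F(ν) = ∫_𝔞 φ(H) e^{ν(H)} dH` with `φ : 𝔞 → ℂ` smooth
and `tsupport φ ⊆ B̄(0, r)` (Lebesgue measure of the induced inner product; the Fourier–Laplace convention `e^{ν(H)}`,
for which `PW_r` is Schwartz on the unitary axis `i𝔞*` — «`π^P_{δ,ν}` est unitaire dès que `ν ∈ i𝔞*`», p. 194 — and
of exponential type `r` in `Re ν`). [cite: ClozelDelorme1990, §0 (p. 194)] -/
def paleyWiener (𝔞 : Submodule ℝ 𝔞₀) (r : ℝ) : Set ((𝔞 →ₗ[ℝ] ℂ) → ℂ) :=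
  {F | ∃ φ : 𝔞 → ℂ, ContDiff ℝ (⊤ : ℕ∞) φ ∧ tsupport φ ⊆ Metric.closedBall 0 r ∧
    ∀ ν : 𝔞 →ₗ[ℝ] ℂ, F ν = ∫ H : 𝔞, φ H * Complex.exp (ν H)}

/-! ## §1 The interface: the data THÉORÈME 1 quantifies over (pp. 194–195) -/

/-- **The data of THÉORÈME 1** (pp. 194–195) for `G = 𝐆(ℝ)`, `𝐆` connected reductive over `ℝ`, with Cartan
involution `θ`, maximal compact `K`, invariant form `B` (p. 194) and a fixed minimal parabolic `P_∅ = M_∅A_∅N_∅`; the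
ambient Euclidean space is `𝔞₀ = 𝔞_∅ = Lie A_∅` with `B`.  FIELDS (carriers only, NO properties):
* `ι` — «`P_i = M_iA_iN_i`, `i = 1, …, S`, l'ensemble (fini) des sous-groupes paraboliques de `G` contenant `P_∅`»
  (p. 194), with `le i j` = «`P_i ⊂ P_j`» and `𝔞 i` = `𝔞_i = Lie A_i ⊆ 𝔞_∅` (then `𝔞_j ⊆ 𝔞_i`, `𝔞_i = 𝔞_j ⊕ 𝔞_i^j`,
  `A_i^j = A_i ∩ M_j`, p. 194);
* `LSD i` — «`M̂_d`, l'ensemble des (classes de) représentations unitaires irréductibles de `M` qui sont des limites de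
  série discrète non dégénérées» for `M = M_i` (p. 194);
* `Rep` — a type of (classes of) admissible representations of `G`, receiving the «représentations basiques»
  `basic i δ ν = π^{P_i}_{δ,ν} = Ind_{P_i}^G(δ ⊗ e^ν ⊗ 1_N)`, `δ ∈ (M̂_i)_d`, `ν ∈ (𝔞_i*)_ℂ` (p. 194);
* `TestFun` — «`C_c^∞(G, K)`, l'espace des fonctions `C^∞` à support compact `K`-finies à droite et à gauche»,
  with `InRadius r f` = «`f ∈ C_c^∞(G, K)_r`», support in `K exp 𝔞(r) K` (p. 194), and `trace π f = tr π(f)` (the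
  distribution character evaluated at `f`);
* `ConjK` — «les données `(M_i, A_i, δ, ν)`, `(M_j, A_j, δ′, ν′)` sont conjuguées par un élément de `K`» (p. 195 (iii));
* `Star i j δ_i {δ_l^j}` — relation (∗) of p. 194: for `M_i ⊂ M_j`, `ind^{M_j}(δ_i ⊗ 1 ⊗ 1) = ⊕_{l=1}^T δ_l^j` with
  `δ_l^j ∈ (M̂_j)_d` (the multiset `{δ_l^j}`);
* `top`, `IsDS` — the index of `P = G` and the discrete series `Ĝ_d ⊆ (M̂_G)_d` (for the Corollaire, p. 213).
[cite: ClozelDelorme1990, §0 (pp. 194–195)] -/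
structure PWDatum where
  /-- Index set of the standard parabolics `P_1, …, P_S ⊇ P_∅` (including `G`). -/
  ι : Type v
  /-- `P_i ⊂ P_j`. -/
  le : ι → ι → Prop
  /-- `𝔞_i = Lie A_i ⊆ 𝔞_∅`. -/
  𝔞 : ι → Submodule ℝ 𝔞₀
  /-- `(M̂_i)_d`: non-degenerate limits of discrete series of `M_i`. -/
  LSD : ι → Type v
  /-- Classes of admissible representations of `G`. -/
  Rep : Type v
  /-- `π^{P_i}_{δ,ν}`. -/
  basic : (i : ι) → LSD i → (𝔞 i →ₗ[ℝ] ℂ) → Rep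
  /-- `C_c^∞(G, K)`. -/
  TestFun : Type v
  /-- `f ∈ C_c^∞(G, K)_r` (support in `K exp 𝔞(r) K`). -/
  InRadius : ℝ → TestFun → Prop
  /-- `tr π(f)`. -/
  trace : Rep → TestFun → ℂ
  /-- `K`-conjugacy of data `(M_i, A_i, δ, ν)`. -/
  ConjK : (Σ i, LSD i × (𝔞 i →ₗ[ℝ] ℂ)) → (Σ i, LSD i × (𝔞 i →ₗ[ℝ] ℂ)) → Prop
  /-- Relation (∗) of p. 194 between `δ_i ∈ (M̂_i)_d` and a multiset `{δ_l^j} ⊆ (M̂_j)_d`, `M_i ⊂ M_j`. -/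
  Star : (i j : ι) → LSD i → Multiset (LSD j) → Prop
  /-- The index of `P = G`. -/
  top : ι
  /-- The discrete series `Ĝ_d` inside `(M̂_G)_d`. -/
  IsDS : LSD top → Prop

namespace PWDatum

variable {𝔞₀}
variable (D : PWDatum.{u, v} 𝔞₀)

/-- The inclusion «`(𝔞_j*)_ℂ ⊂ (𝔞_i*)_ℂ`» for `P_i ⊂ P_j` (p. 195 (iv); p. 194: `A_i = A_j A_i^j`): a functional on
`𝔞_j` is extended to `𝔞_i` by zero on the `B`-orthogonal complement, i.e. precomposed with the orthogonal projection
`𝔞_i → 𝔞_j` (Mathlib `Submodule.orthogonalProjectionOnto`).  Typed for any pair of indices; used under `D.le i j`,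
when `𝔞_j ⊆ 𝔞_i`. [cite: ClozelDelorme1990, Thm. 1 (iv) (p. 195)] -/
def dualIncl (i j : D.ι) (ν : D.𝔞 j →ₗ[ℝ] ℂ) : D.𝔞 i →ₗ[ℝ] ℂ :=
  ν ∘ₗ ((D.𝔞 j).orthogonalProjectionOnto.toLinearMap ∘ₗ (D.𝔞 i).subtype)

/-! ## §2 THÉORÈME 1 (p. 195) -/

/-- Condition (i) of THÉORÈME 1 (p. 195): «Pour tout `i`, `F_i` est à support fini en `δ`, i.e. sauf pour un nombre
fini de `δ ∈ (M̂_i)_d`, l'application `ν → F_i(δ, ν)` est identiquement nulle sur `(𝔞_i*)_ℂ`.»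
[cite: ClozelDelorme1990, Thm. 1 (i) (p. 195)] -/
def CondI (F : (i : D.ι) → D.LSD i → (D.𝔞 i →ₗ[ℝ] ℂ) → ℂ) : Prop :=
  ∀ i : D.ι, {δ : D.LSD i | ∃ ν, F i δ ν ≠ 0}.Finite

/-- Condition (ii) of THÉORÈME 1 (p. 195): «Pour tout `i`, `δ ∈ (M̂_i)_d`, `ν → F_i(δ, ν)` appartient comme fonction de
`ν` à `PW_r(𝔞_i)`.» [cite: ClozelDelorme1990, Thm. 1 (ii) (p. 195)] -/
def CondII (r : ℝ) (F : (i : D.ι) → D.LSD i → (D.𝔞 i →ₗ[ℝ] ℂ) → ℂ) : Prop :=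
  ∀ (i : D.ι) (δ : D.LSD i), (fun ν => F i δ ν) ∈ paleyWiener (D.𝔞 i) r

/-- Condition (iii) of THÉORÈME 1 (p. 195): «On a `F_i(δ, ν) = F_j(δ′, ν′)` dès que les données `(M_i, A_i, δ, ν)`,
`(M_j, A_j, δ′, ν′)` sont conjuguées par un élément de `K`. En particulier, pour tout `w ∈ W(A_i)`, `δ ∈ (M̂_i)_d`,
`ν ∈ (𝔞_i*)_ℂ`, `F_i(δ, ν) = F_i(wδ, wν)`» (the «en particulier» is the case of `K`-conjugacy by a representative of
`w` in `Norm_K(A_i)` and is not typed separately). [cite: ClozelDelorme1990, Thm. 1 (iii) (p. 195)] -/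
def CondIII (F : (i : D.ι) → D.LSD i → (D.𝔞 i →ₗ[ℝ] ℂ) → ℂ) : Prop :=
  ∀ (i j : D.ι) (δ : D.LSD i) (ν : D.𝔞 i →ₗ[ℝ] ℂ) (δ' : D.LSD j) (ν' : D.𝔞 j →ₗ[ℝ] ℂ),
    D.ConjK ⟨i, (δ, ν)⟩ ⟨j, (δ', ν')⟩ → F i δ ν = F j δ' ν'

/-- Condition (iv) of THÉORÈME 1 (p. 195): «Supposons que `P_i ⊂ P_j` et que `δ_i ∈ (M̂_i)_d` et `δ_l^j ∈ (M̂_j)_d`,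
`l = 1, …, T` vérifient la relation (∗). Alors, pour tout `ν ∈ (𝔞_j*)_ℂ ⊂ (𝔞_i*)_ℂ`, on a
`F_i(δ_i, ν) = Σ_{l=1}^T F_j(δ_l^j, ν)`.» [cite: ClozelDelorme1990, Thm. 1 (iv) (p. 195)] -/
def CondIV (F : (i : D.ι) → D.LSD i → (D.𝔞 i →ₗ[ℝ] ℂ) → ℂ) : Prop :=
  ∀ (i j : D.ι), D.le i j → ∀ (δi : D.LSD i) (δs : Multiset (D.LSD j)), D.Star i j δi δs →
    ∀ ν : D.𝔞 j →ₗ[ℝ] ℂ, F i δi (D.dualIncl i j ν) = (δs.map fun δ => F j δ ν).sum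

/-- **THÉORÈME 1** (p. 195): «Soit `r > 0`. Supposons données pour `i = 1, …, S` des fonctions
`F_i : (M̂_i)_d × (𝔞_i*)_ℂ → ℂ`. Les conditions (a) et (b) suivantes sont équivalentes. (a) Il existe
`f ∈ C_c^∞(G, K)_r` telle que `F_i(δ, ν) = tr π^{P_i}_{δ,ν}(f)` pour `i = 1, …, S`. (b) Les fonctions `F_i` ont les
propriétés (i)–(iv)» (`CondI`–`CondIV`).  A predicate ON the datum `D` (no real reductive groups in Mathlib), to be
asserted by a consumer for the genuine datum of its group `G = 𝐆(ℝ)`. [cite: ClozelDelorme1990, Thm. 1 (p. 195)] -/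
def Theoreme_1 (r : ℝ) (F : (i : D.ι) → D.LSD i → (D.𝔞 i →ₗ[ℝ] ℂ) → ℂ) : Prop :=
  0 < r →
    ((∃ f : D.TestFun, D.InRadius r f ∧ ∀ (i : D.ι) (δ : D.LSD i) (ν : D.𝔞 i →ₗ[ℝ] ℂ),
        F i δ ν = D.trace (D.basic i δ ν) f) ↔
      (D.CondI F ∧ D.CondII r F ∧ D.CondIII F ∧ D.CondIV F))

end PWDatum

/-! ## §3 THÉORÈME 1′ (§5.1, pp. 211–212): Arthur's form -/

/-- The extra data of §5.1 (p. 211): the set `𝓛` of Levi subgroups `M` of `G` («`M` — au lieu de `MA` — désigne un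
sous-groupe de Levi», footnote (2)), their split components `𝔞_M ⊆ 𝔞₀`, the tempered duals «`Π_temp(M)`, l'ensemble des
(classes de) représentations irréductibles [tempérées]», the unitarily induced `π_λ = ind_{MN}^G(π ⊗ e^λ)` for
`λ ∈ i𝔞_M*` (parametrised by the REAL functional `λ ∈ 𝔞_M*`, `e^{iλ}`), `Π_temp(G) → Rep`, the `K`-types of a
representation and the space `C_c^∞(G, K)_{F,r}` of test functions «se transformant sous `F`» (p. 211).
[cite: ClozelDelorme1990, §5.1 (p. 211)] -/
structure TempDatum extends PWDatum.{u, v} 𝔞₀ where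
  /-- Levi subgroups of `G`. -/
  Levi : Type v
  /-- `𝔞_M`. -/
  𝔞M : Levi → Submodule ℝ 𝔞₀
  /-- `Π_temp(M)`. -/
  Temp : Levi → Type v
  /-- `Π_temp(G)`. -/
  TempG : Type v
  /-- `π_λ = ind(π ⊗ e^{iλ})`, `λ ∈ 𝔞_M*`, as a (class of) tempered representation(s) of `G` — an element of the free
  `ℤ`-module `ℤ[Π_temp(G)]` («on peut considérer `π_λ` comme un élément de `ℤ(Π_temp(G))`», p. 211). -/
  indTemp : (M : Levi) → Temp M → (𝔞M M →ₗ[ℝ] ℝ) → (TempG →₀ ℤ)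
  /-- `Π_temp(G) ⊆ Rep`. -/
  ofTemp : TempG → Rep
  /-- `K`-types. -/
  KType : Type v
  /-- «`π` a un `K`-type dans `F`»: the `K`-types occurring in `π`. -/
  HasKType : TempG → KType → Prop
  /-- `f ∈ C_c^∞(G, K)_{F,r}`: «fonctions de `C_c^∞(G, K)_r` se transformant sous `F`» (p. 211). -/
  TransformsUnder : Finset KType → TestFun → Prop
  /-- «`F` est saturé pour l'ordre sur `K̂` introduit dans [7] 2.3» (p. 212). -/
  IsSaturated : Finset KType → Prop

namespace TempDatum

variable {𝔞₀}
variable (T : TempDatum.{u, v} 𝔞₀)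

/-- The point `iλ_H ∈ i𝔞_M* ⊂ (𝔞_M*)_ℂ` of the UNITARY AXIS attached to `H ∈ 𝔞_M` by the form `B` (`λ_H = B(H, ·)`): the
complex functional `X ↦ i·B(H, X)` on `𝔞_M`. [cite: ClozelDelorme1990, §5.1 (p. 211)] -/
def unitaryAxis (V : Submodule ℝ 𝔞₀) (H : V) : V →ₗ[ℝ] ℂ :=
  Complex.I • (Complex.ofRealLI.toLinearMap ∘ₗ ((innerSL ℝ (V.subtype H)).toLinearMap ∘ₗ V.subtype))

/-- The real functional `λ_H = B(H, ·) ∈ 𝔞_M*` attached to `H ∈ 𝔞_M` (identification `𝔞_M ≅ 𝔞_M*` by `B`, p. 194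
«On se fixe une forme bilinéaire invariante `B`»; p. 211 «Fixons des normes sur les `𝔞_M` de la façon habituelle»).
[cite: ClozelDelorme1990, §5.1 (p. 211)] -/
def realFunctional (V : Submodule ℝ 𝔞₀) (H : V) : V →ₗ[ℝ] ℝ :=
  (innerSL ℝ (V.subtype H)).toLinearMap ∘ₗ V.subtype

/-- **`J_F(G)_r`** (p. 211): the functions `φ : Π_temp(G) → ℂ` (extended `ℤ`-linearly to `ℤ[Π_temp(G)]`, «`φ̃`») such
that «(i) Si `π ∈ Π_temp(G)` n'a aucun `K`-type dans `F`, `φ(π) = 0`. (ii) Pour tout `M ∈ 𝓛`, `π ∈ Π_temp(M)`, la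
fonction `Φ(π, X) = ∫_{i𝔞_M*} φ̃(π_ν) e^{−ν(X)} dν` définie pour `X ∈ 𝔞_M`, s'annule pour `‖X‖ > r`».  Condition (ii)
— whose «définie» presupposes that `ν ↦ φ̃(π_ν)` is integrable on the unitary axis, and whose use («Le théorème 1′ se
déduit immédiatement du théorème 1 à l'aide des propriétés de la transformation de Fourier inverse et des
restrictions de fonctions de Paley–Wiener à un sous-espace», p. 212) presupposes it is a Paley–Wiener function — is
typed in the EQUIVALENT Paley–Wiener form that carries exactly this regularity: `λ ↦ φ̃(π_λ)` (`λ = λ_H ∈ 𝔞_M*`,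
`H ∈ 𝔞_M`) is the restriction to the unitary axis `ν = iλ_H` of an element of `PW_r(𝔞_M)` (`paleyWiener`), i.e.
`φ̃(π_{λ_H}) = ∫_{𝔞_M} Φ(X) e^{iB(H,X)} dX` with `Φ ∈ C_c^∞(𝔞_M)`, `tsupport Φ ⊆ B̄(0, r)` — this `Φ` IS print's
`Φ(π, ·)` up to the normalisation of the inverse Fourier transform, and its support condition is print's «s'annule pour
`‖X‖ > r`» (reviewer of p847963, objection 1: a bare Bochner integral `= 0` without integrability would be vacuous).
[cite: ClozelDelorme1990, §5.1 (p. 211)] -/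
def CondJF (F : Finset T.KType) (r : ℝ) (φ : T.TempG → ℂ) : Prop :=
  (∀ π : T.TempG, (∀ τ ∈ F, ¬ T.HasKType π τ) → φ π = 0) ∧
    ∀ (M : T.Levi) (π : T.Temp M), ∃ Φ ∈ paleyWiener (T.𝔞M M) r, ∀ H : T.𝔞M M,
      (Finsupp.sum (T.indTemp M π (realFunctional (T.𝔞M M) H)) fun ρ n => (n : ℂ) * φ ρ) =
        Φ (unitaryAxis (T.𝔞M M) H)

/-- **THÉORÈME 1′** (pp. 211–212): «L'application `f → φ(f) : φ(f)(π) = trace π(f)`, `π ∈ Π_temp(G)` est une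
application surjective : `C_c^∞(G, K)_{F,r} → J_F(G)_r`, dès que `F` est saturé …» — every `φ ∈ J_F(G)_r` (`CondJF`)
is `π ↦ tr π(f)` for some `f ∈ C_c^∞(G, K)_{F,r}` (that `φ(f) ∈ J_F(G)_r` for such `f` is part of «application … →
J_F(G)_r» and is included).  Predicate on the datum. [cite: ClozelDelorme1990, Thm. 1′ (pp. 211–212)] -/
def Theoreme_1prime (F : Finset T.KType) (r : ℝ) : Prop :=
  0 < r → T.IsSaturated F →
    (∀ f : T.TestFun, T.TransformsUnder F f → T.InRadius r f →
        T.CondJF F r (fun π => T.trace (T.ofTemp π) f)) ∧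
      ∀ φ : T.TempG → ℂ, T.CondJF F r φ →
        ∃ f : T.TestFun, T.TransformsUnder F f ∧ T.InRadius r f ∧ ∀ π, φ π = T.trace (T.ofTemp π) f

end TempDatum

namespace PWDatum

variable {𝔞₀}
variable (D : PWDatum.{u, v} 𝔞₀)

/-! ## §4 COROLLAIRE «existence de pseudo-coefficients» (§5.2, p. 213) -/

/-- **COROLLAIRE (Existence de pseudo-coefficients)** (p. 213), under the standing hypothesis of §5.2 «Supposons le
centre de `G` compact» (p. 212; the printed proof goes through Proposition 4, «`G` de centre compact»), recorded as
`𝔞_G = 0` (`D.𝔞 D.top = ⊥`; reviewer of p847963, objection 2): «Soit `δ₀ ∈ Ĝ_d`. Alors, pour tout `r > 0`, il existe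
`f ∈ C_c^∞(G, K)_r` telle que (i) `tr δ₀(f) = 1`, (ii) `tr π^P_{δ,ν}(f) = 0` pour toute représentation basique
`π^P_{δ,ν}` de `G` différente de `δ₀`. Une fonction `f` satisfaisant ces conditions est appelée pseudo-coefficient de
`δ₀`.»  Here `δ₀` is the basique representation `π^{G}_{δ₀,0}` (`D.top`, `ν = 0`) and «différente» is inequality of
classes in `D.Rep`. [cite: ClozelDelorme1990, §5.2 Corollaire (p. 213)] -/
def Corollaire_pseudoCoefficient (δ₀ : D.LSD D.top) : Prop :=
  D.𝔞 D.top = ⊥ → D.IsDS δ₀ → ∀ r : ℝ, 0 < r → ∃ f : D.TestFun, D.InRadius r f ∧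
    D.trace (D.basic D.top δ₀ 0) f = 1 ∧
      ∀ (i : D.ι) (δ : D.LSD i) (ν : D.𝔞 i →ₗ[ℝ] ℂ),
        D.basic i δ ν ≠ D.basic D.top δ₀ 0 → D.trace (D.basic i δ ν) f = 0

end PWDatum

end Literature.RepresentationTheory.ClozelDelorme1990

end
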